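import Summits.Ventures.HodgeRepro2.T5SU11SphericalRegular
import Summits.Ventures.HodgeRepro2.T5SU11SphericalGreen
import Summits.Ventures.HodgeRepro2.T5SU11SphericalDecayAsymptotic
import Summits.Ventures.HodgeRepro2.T5SU11SphericalDecayEdgeAsymptotic
import Summits.Ventures.HodgeRepro2.T5SU11SphericalGreenEdge
import Summits.Ventures.HodgeRepro2.T5SU11LegendreSecondKindIntegral

/-!
# Summary VII — the radial spectral theory of the explicit model at every parameter `λ` (rows 443–458), under uniform names

The headline statements of rows 443–458 about the radial equation
`sinh 2t · u″ + 2 cosh 2t · u′ = λ(λ − 2) sinh 2t · u` of `SU(1,1)` on `(0, ∞)`, re-exported: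

* `radial_solution_space` — at every real `λ` the solution space on `(0, ∞)` is two-dimensional, spanned by the
  spherical function `φ_λ(a_·)` and its reduction-of-order companion `ψ_λ` (row 444);
* `radial_regular_unique` — a solution bounded as `t → 0⁺` is a multiple of `φ_λ(a_·)`, and
  `radial_eq_sph_of_tendsto_one` — a solution with limit `1` at `0⁺` IS `φ_λ(a_·)` (row 446);
* `radial_decay_exists` — for `λ > 1` the decaying solution `χ_λ > 0` with `χ_λ/φ_λ → 0` and Wronskian `−1`
  (row 448), `radial_decay_unique` — unique up to a constant, `radial_decay_rate` — `e^{λt} χ_λ → 1/((λ−1) c(2−λ))`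
  (row 450);
* `radial_edge_decay_exists`, `radial_edge_decay_rate` — the same at the spectral edge `λ = 1`:
  `χ_1/Ξ → 0`, `e^{t} χ_1 → π/2` (rows 453, 455);
* `radial_green_ode`, `radial_green_unique` — the Green's solution of the inhomogeneous equation for `λ > 1` and its
  characterisation by boundedness at `0` and decay relative to `φ_λ` (row 452); `radial_edge_green_unique` — the
  same at `λ = 1` (row 457);
* `legendreQ_eq_decay`, `legendreQ_rate`, `legendreQ_integral_formula` — at `λ = 2n + 2`: `Q_n(cosh 2t) = 2 χ_{2n+2}(t)`,
  the rate of `Q_n(cosh 2t)` from the general theory, and the classical `Q_n(x) = P_n(x) ∫_x^∞ dy/((y² − 1) P_n(y)²)`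
  (rows 448, 450, 458).

Nothing is claimed about (N).

Blind lane: Mathlib + the HodgeRepro2 prefix only; no sorry; axioms ⊆ {propext, Classical.choice,
Quot.sound}.
-/

namespace Summit.Ventures.HodgeRepro2.T5SU11RadialSummaryVII

open Filter Topology
open Set (Ioi)
open scoped Real
open T5SU11Cartan T5SU11SphericalFunction T5SU11SphericalAsymptotic T5SU11ReductionOfOrder
  T5SU11ReductionOfOrderInfinity T5SU11SphericalSolutionSpaceAll T5SU11SphericalRegular T5SU11SphericalDecay
  T5SU11SphericalDecayAsymptotic T5SU11SphericalDecayEdge T5SU11SphericalDecayEdgeAsymptotic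
  T5SU11SphericalGreen T5SU11SphericalSecondKind T5SU11JacobiLegendreLeading T5SU11SphericalGreenEdge
  T5SU11LegendreSecondKindIntegral T5SU11SphericalLegendreAll T5SU11LegendreSecondKind

section measure

variable [MeasurableSpace Circle] [BorelSpace Circle]

/-- **The solution space at every `λ`** (row 444): every solution on `(0, ∞)` is `a φ_λ(a_·) + b ψ_λ`. -/
theorem radial_solution_space (lam : ℝ) {u u' u'' : ℝ → ℝ}
    (hu : ∀ t, 0 < t → HasDerivAt u (u' t) t) (hu' : ∀ t, 0 < t → HasDerivAt u' (u'' t) t)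
    (hode : ∀ t, 0 < t → Real.sinh (2 * t) * u'' t + 2 * Real.cosh (2 * t) * u' t
      = lam * (lam - 2) * Real.sinh (2 * t) * u t) :
    ∃ a b : ℝ, ∀ t, 0 < t → u t = a * sph lam (hyp t) + b * sphSecond lam t :=
  T5SU11SphericalSolutionSpaceAll.exists_eq_add_of_ode lam hu hu' hode

/-- **The regular solution is unique** (row 446): a solution bounded as `t → 0⁺` is a multiple of `φ_λ(a_·)`. -/
theorem radial_regular_unique (lam : ℝ) {u u' u'' : ℝ → ℝ}
    (hu : ∀ t, 0 < t → HasDerivAt u (u' t) t) (hu' : ∀ t, 0 < t → HasDerivAt u' (u'' t) t)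
    (hode : ∀ t, 0 < t → Real.sinh (2 * t) * u'' t + 2 * Real.cosh (2 * t) * u' t
      = lam * (lam - 2) * Real.sinh (2 * t) * u t)
    {B : ℝ} (hB : ∀ᶠ t in 𝓝[>] (0 : ℝ), |u t| ≤ B) :
    ∃ c : ℝ, ∀ t, 0 < t → u t = c * sph lam (hyp t) :=
  exists_eq_const_mul_sph_of_bounded lam hu hu' hode hB

/-- **The spherical function is the solution with limit `1` at the origin** (row 446). -/
theorem radial_eq_sph_of_tendsto_one (lam : ℝ) {u u' u'' : ℝ → ℝ}
    (hu : ∀ t, 0 < t → HasDerivAt u (u' t) t) (hu' : ∀ t, 0 < t → HasDerivAt u' (u'' t) t)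
    (hode : ∀ t, 0 < t → Real.sinh (2 * t) * u'' t + 2 * Real.cosh (2 * t) * u' t
      = lam * (lam - 2) * Real.sinh (2 * t) * u t)
    (hL : Tendsto u (𝓝[>] 0) (𝓝 1)) {t : ℝ} (ht : 0 < t) : u t = sph lam (hyp t) :=
  eq_sph_hyp_of_ode_of_tendsto lam hu hu' hode hL ht

/-- **The decaying solution for `λ > 1`** (row 448): `χ_λ > 0` solves the equation, has Wronskian `−1` against `φ_λ`
and `χ_λ/φ_λ → 0`. -/
theorem radial_decay_exists {lam : ℝ} (hlam : 1 < lam) :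
    (∀ t, 0 < t → 0 < sphDecay lam t) ∧
    (∀ t, 0 < t → Real.sinh (2 * t) * sphDecay'' lam t + 2 * Real.cosh (2 * t) * sphDecay' lam t
      = lam * (lam - 2) * Real.sinh (2 * t) * sphDecay lam t) ∧
    (∀ t, 0 < t → Real.sinh (2 * t) * (sph lam (hyp t) * sphDecay' lam t
      - deriv (fun t => sph lam (hyp t)) t * sphDecay lam t) = -1) ∧
    Tendsto (fun t => sphDecay lam t / sph lam (hyp t)) atTop (𝓝 0) :=
  ⟨fun _ ht => sphDecay_pos hlam ht, fun _ ht => sphDecay_ode hlam ht, fun _ ht => wronskian_sphDecay hlam ht,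
    tendsto_sphDecay_div_atTop hlam⟩

/-- **The decaying solution is unique up to a constant** (row 448). -/
theorem radial_decay_unique {lam : ℝ} (hlam : 1 < lam) {u u' u'' : ℝ → ℝ}
    (hu : ∀ t, 0 < t → HasDerivAt u (u' t) t) (hu' : ∀ t, 0 < t → HasDerivAt u' (u'' t) t)
    (hode : ∀ t, 0 < t → Real.sinh (2 * t) * u'' t + 2 * Real.cosh (2 * t) * u' t
      = lam * (lam - 2) * Real.sinh (2 * t) * u t)
    (hdecay : Tendsto (fun t => u t / sph lam (hyp t)) atTop (𝓝 0)) :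
    ∃ c : ℝ, ∀ t, 0 < t → u t = c * sphDecay lam t :=
  exists_eq_const_mul_sphDecay_of_tendsto hlam hu hu' hode hdecay

/-- **The exact decay rate** (row 450): `e^{λt} χ_λ(t) → 1/((λ − 1) c(2 − λ))`. -/
theorem radial_decay_rate {lam : ℝ} (hlam : 1 < lam) :
    Tendsto (fun t => Real.exp (lam * t) * sphDecay lam t) atTop (𝓝 (1 / ((lam - 1) * cfun (2 - lam)))) :=
  tendsto_exp_mul_sphDecay hlam

/-- **The decaying solution at the spectral edge `λ = 1`** (row 453). -/
theorem radial_edge_decay_exists :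
    (∀ t, 0 < t → 0 < sphDecay 1 t) ∧
    (∀ t, 0 < t → Real.sinh (2 * t) * sphDecay'' 1 t + 2 * Real.cosh (2 * t) * sphDecay' 1 t
      = 1 * (1 - 2) * Real.sinh (2 * t) * sphDecay 1 t) ∧
    (∀ t, 0 < t → Real.sinh (2 * t) * (sph 1 (hyp t) * sphDecay' 1 t
      - deriv (fun t => sph 1 (hyp t)) t * sphDecay 1 t) = -1) ∧
    Tendsto (fun t => sphDecay 1 t / sph 1 (hyp t)) atTop (𝓝 0) :=
  ⟨fun _ ht => sphDecay_one_pos ht, fun _ ht => sphDecay_one_ode ht, fun _ ht => wronskian_sphDecay_one ht,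
    tendsto_sphDecay_one_div_atTop⟩

/-- **The rate at the edge** (row 455): `e^{t} χ_1(t) → π/2`. -/
theorem radial_edge_decay_rate : Tendsto (fun t => Real.exp t * sphDecay 1 t) atTop (𝓝 (π / 2)) :=
  tendsto_exp_mul_sphDecay_one

/-- **The Green's solution** (row 452): `G_λ f` solves the inhomogeneous equation for `λ > 1`. -/
theorem radial_green_ode {lam : ℝ} (hlam : 1 < lam) (f : ℝ → ℝ) (a b : ℝ) {t : ℝ} (ht : 0 < t) :
    Real.sinh (2 * t) * sphGreen'' lam f a b t + 2 * Real.cosh (2 * t) * sphGreen' lam f a b t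
      = lam * (lam - 2) * Real.sinh (2 * t) * sphGreen lam f a b t + Real.sinh (2 * t) * f t :=
  sphGreen_ode hlam ht

/-- **The Green's solution is the unique bounded-and-decaying solution** (row 452). -/
theorem radial_green_unique {lam a b : ℝ} {f : ℝ → ℝ} (hlam : 1 < lam) (hf : ContinuousOn f (Ioi 0))
    (ha : 0 < a) (hab : a ≤ b) (hfa : ∀ s, s ≤ a → f s = 0) (hfb : ∀ s, b ≤ s → f s = 0)
    {v v' v'' : ℝ → ℝ} (hv : ∀ t, 0 < t → HasDerivAt v (v' t) t) (hv' : ∀ t, 0 < t → HasDerivAt v' (v'' t) t)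
    (hvode : ∀ t, 0 < t → Real.sinh (2 * t) * v'' t + 2 * Real.cosh (2 * t) * v' t
      = lam * (lam - 2) * Real.sinh (2 * t) * v t + Real.sinh (2 * t) * f t)
    {B : ℝ} (hB : ∀ᶠ t in 𝓝[>] (0 : ℝ), |v t| ≤ B)
    (hdecay : Tendsto (fun t => v t / sph lam (hyp t)) atTop (𝓝 0)) {t : ℝ} (ht : 0 < t) :
    v t = sphGreen lam f a b t :=
  eq_sphGreen_of_ode hlam hf ha hab hfa hfb hv hv' hvode hB hdecay ht

/-- **The Green's solution at the edge is unique** (row 457). -/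
theorem radial_edge_green_unique {a b : ℝ} {f : ℝ → ℝ} (hf : ContinuousOn f (Ioi 0))
    (ha : 0 < a) (hab : a ≤ b) (hfa : ∀ s, s ≤ a → f s = 0) (hfb : ∀ s, b ≤ s → f s = 0)
    {v v' v'' : ℝ → ℝ} (hv : ∀ t, 0 < t → HasDerivAt v (v' t) t) (hv' : ∀ t, 0 < t → HasDerivAt v' (v'' t) t)
    (hvode : ∀ t, 0 < t → Real.sinh (2 * t) * v'' t + 2 * Real.cosh (2 * t) * v' t
      = 1 * (1 - 2) * Real.sinh (2 * t) * v t + Real.sinh (2 * t) * f t)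
    {B : ℝ} (hB : ∀ᶠ t in 𝓝[>] (0 : ℝ), |v t| ≤ B)
    (hdecay : Tendsto (fun t => v t / sph 1 (hyp t)) atTop (𝓝 0)) {t : ℝ} (ht : 0 < t) :
    v t = sphGreen 1 f a b t :=
  eq_sphGreen_one_of_ode hf ha hab hfa hfb hv hv' hvode hB hdecay ht

/-- **`Q_n(x) = P_n(x) ∫_x^∞ dy/((y² − 1) P_n(y)²)`** for `x > 1` (row 458). -/
theorem legendreQ_integral_formula (n : ℕ) {x : ℝ} (hx : 1 < x) :
    legQ2 n x = legP n x * ∫ y in Ioi x, legKernel n y :=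
  legQ2_eq_legP_mul_integral n hx

/-- **`Q_n(cosh 2t) = 2 χ_{2n+2}(t)`** (row 448). -/
theorem legendreQ_eq_decay (n : ℕ) {t : ℝ} (ht : 0 < t) : sphQ n t = 2 * sphDecay (2 * (n : ℝ) + 2) t :=
  sphQ_eq_two_mul_sphDecay n ht

/-- **The rate of `Q_n(cosh 2t)` from the general theory** (row 450): `e^{(2n+2)t} Q_n(cosh 2t) → 2^{n+1}/((2n+1) lc_n)`. -/
theorem legendreQ_rate (n : ℕ) :
    Tendsto (fun t => Real.exp ((2 * (n : ℝ) + 2) * t) * sphQ n t) atTop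
      (𝓝 (2 ^ (n + 1) / ((2 * (n : ℝ) + 1) * legLead n))) := by
  have h := tendsto_exp_mul_sphQ' n
  rwa [sphQ_limit_consistency] at h

end measure

end Summit.Ventures.HodgeRepro2.T5SU11RadialSummaryVII
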